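import Literature.Computability.AlgebraicComplexity.NilCoxeterTensor
import Summits.MatrixMultiplication.MatrixMultiplication.Theses.NilCoxeterShadow

/-!
# `NilCoxeterShadow.DegenerationTransfer` — `bR(T_{NC_n}) ≤ R(T_{ℂ[S_n]})`

Item `stmt-MatrixMultiplication-0961` (support, rank 9, route `MatrixMultiplication/NilCoxeterShadow`):
for every `n`, the border rank (over `ℂ[ε]`, Bläser 2013, Def. 6.1, `algBorderRank`) of the structure
tensor of the nil-Coxeter algebra `NC_n = gr ℂ[S_n]` — inlined in the route file over
`Equiv.Perm (Fin n)` with entry `[x·y = z ∧ inv z = inv x + inv y]`, `inv` the inversion number — is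
at most the rank of the structure tensor `groupTensor ℂ (Equiv.Perm (Fin n))` of the group algebra
`ℂ[S_n]`.

The mathematics lives in `Literature/Computability/AlgebraicComplexity/NilCoxeterTensor.lean`:
from an exact decomposition `T_{ℂ[S_n]} = ∑_ρ w_ρ ⊗ u_ρ ⊗ v_ρ` the Rees twist
`w_ρ(z) ↦ ε^{h - inv z} w_ρ(z)`, `u_ρ(x) ↦ ε^{inv x} u_ρ(x)`, `v_ρ(y) ↦ ε^{inv y} v_ρ(y)` (`h = n(n-1)/2`)
is an order-`h` approximate decomposition of `T_{NC_n}` (`inv(xy) ≤ inv x + inv y` with equality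
exactly on the support), whence `algBorderRank ≤ approxRank h ≤ tensorRank`
(`algBorderRank_nilCoxeterTensor_le`; Bläser–Lysikov 2016, §2.3, Lemma 4). The route decl is that
statement at `K = ℂ` up to the definitional bridge `nilCoxeterTensor_eq` (the route spells
`inversionNumber` out as a `Finset.card`), so the proof here is a transport along `rfl`.
-/

-- `Summit.<Summit>.<Problem>` is the tree's mandated summit-side namespace; for this
-- single-conjunct summit the two coincide, so the file silences `dupNamespace`.
set_option linter.dupNamespace false

namespace Summit.MatrixMultiplication.MatrixMultiplication.Theorems

open Literature.Computability.AlgebraicComplexity in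
/-- **Degeneration transfer** (item `stmt-MatrixMultiplication-0961`): for every `n`,
`bR(T_{NC_n}) ≤ R(T_{ℂ[S_n]})` — the border rank of the structure tensor of the nil-Coxeter algebra
`NC_n = gr ℂ[S_n]` (route-inlined form) is at most the tensor rank of `groupTensor ℂ S_n`.
Proof: `algBorderRank_nilCoxeterTensor_le ℂ n` (Rees twist of an optimal exact decomposition,
Bläser–Lysikov 2016, §2.3, Lemma 4; Bläser 2013, Def. 6.1), rewritten along the `rfl` bridge
`nilCoxeterTensor_eq` to the inlined tensor of the route file. -/
theorem degenerationTransfer_proof :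
    Summit.MatrixMultiplication.MatrixMultiplication.Theses.NilCoxeterShadow.DegenerationTransfer := by
  unfold Summit.MatrixMultiplication.MatrixMultiplication.Theses.NilCoxeterShadow.DegenerationTransfer
  intro n
  have h := algBorderRank_nilCoxeterTensor_le ℂ n
  rw [nilCoxeterTensor_eq] at h
  exact h

end Summit.MatrixMultiplication.MatrixMultiplication.Theorems
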